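import Summits.BirchSwinnertonDyer.Rank1Residual.Supersingular.MazurTateValuation
import HarnessLib

/-!
# ONE twisted value certifies ALL deeper layers: from `|∑_a χ(a)[a/p^{n+e₀}]⁺_f| > 1/p` at ONE
# layer `n` to the exact valuation of EVERY cyclotomic twist of the same parity at every layer
# `m ≥ n`, and `L^• ≠ 0` (cell `b2b-bsdres`, supersingular family, prover B = unit
# `b2b-bsdres-additive-p3`, gen 10; part 6 — propagation of the one-value certificate)

HONEST FRAMING (run/shared/lean/b2b/bsd-rank1-residual/, verbatim in every file): the goal of the
cell is to DELETE the COMBINATION-SHAPED residual classes of the Birch–Swinnerton-Dyer formula for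
ALL analytic-rank `≤ 1` elliptic curves over `ℚ` — "full BSD formula for every rank `≤ 1` curve in
class `C`" assembled STRICTLY from published theorems — so that the rank-`≤ 1` remainder becomes
exactly the CONSTRUCTION-SHAPED classes, which are TYPED (missing-input `Prop`s), NOT attempted.
This is not "finishing BSD". THEOREMS ONLY (no definition, no named fact, no `sorry`); nothing about
any particular curve is asserted; nothing is booked; X8 / X7 / X6 stay CONSTRUCTION-SHAPED.

## What this file proves (parts 4–5: `MazurTateValuation.lean`, `SignedTwistedValuation.lean`)

Part 4 §10 showed: ONE primitive even `p`-power-order `χ` of conductor `p^{n+e₀}` (`n` odd) with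
`|Birch(χ)| > 1/p` certifies `μ(L♯) = 0` and `λ♯ + deg ω_n^+ < φ(pⁿ)`; §9 needs `L♯ ≠ 0` besides.
Here (for `p ≠ 2` good supersingular, `f` the newform of `E = W`, THE Sprung pair):

* §14 **`L♯ ≠ 0` from the reading** (`sharp_ne_zero_of_reading`, `flat_ne_zero_of_reading`): in the
  mod-`p` reading `Θ̄ = T^{pⁿ}Q̄ ∓ T^{q_n}·L̄♯` of an odd-level Mazur–Tate element with `μ(Θ) = 0`,
  `λ(Θ) < pⁿ`, the colour `L♯` is `≢ 0 (mod p)`, in particular non-zero — so the certificate of §10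
  ALSO gives `L♯ ≠ 0` (`sharp_ne_zero_of_lt_norm`; `♭`/even likewise). (Non-vanishing of `L♯`, `L♭`
  for `a_p ≠ 0` is Sprung 2017 Conj. 4.12 in general; here it is CERTIFIED per pair by one value.)
* §15 **propagation of the hypothesis**: `l + deg ω_n^+ < φ(pⁿ)` at an odd `n` implies the same at
  every odd `m ≥ n` (`add_natDegree_cyclotomicOmegaPlus_lt_totient_of_le`; even/`ω^-` likewise) —
  `deg ω_{n+2}^± = deg ω_n^± + φ(pⁿ⁺¹)` and `φ(pⁿ) + φ(pⁿ⁺¹) ≤ φ(pⁿ⁺²)`.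
* §16 **ONE VALUE ⇒ ALL DEEPER LAYERS** (`norm_ratTwistedSymbolSum_pow_totient_eq_of_lt_norm_of_le`):
  if ONE primitive even `p`-power-order `χ` of conductor `p^{n+e₀}` (`n = k+1` odd) has
  `|∑_a χ(a)[a/p^{n+e₀}]⁺_f| > 1/p`, then for EVERY odd `m = j+1 ≥ n` and EVERY primitive even
  `p`-power-order `χ'` of conductor `p^{m+e₀}`:
  **`|∑_a χ'(a)[a/p^{m+e₀}]⁺_f|^{φ(pᵐ)} = p^{−(deg ω_m^+ + λ♯)}`**, with `λ♯` itself read off `χ`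
  (`λ♯ + deg ω_n^+ = φ(pⁿ)·v_p(Birch(χ))`); `♭`/even likewise. So an engine that certifies ONE
  low-layer twisted value of small valuation has, as a THEOREM, the valuation of every deeper twist
  of that parity (what iw-2's engines B/T observe as "deeper layers re-detect the same `λ^•`").
* §17 X8 forms (`p = 3`).

References: [Pollack2003] Prop. 6.9–6.10; [Sprung2017] §3, Cor. 3.6, Thm. 1.12, Conj. 4.12;
[Washington1997] §7.1–7.2. Memo: HOME/b2b-bsdres-additive-p3/X8-ROUTE-B.md §15 (gen 10).
-/

set_option autoImplicit false

noncomputable section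

open scoped Classical MatrixGroups ModularForm

open CongruenceSubgroup Polynomial WeierstrassCurve Literature.NumberTheory.EllipticCurves
  Literature.NumberTheory.EllipticCurves.ModularForms
  Literature.NumberTheory.EllipticCurves.Sprung2017
  Literature.NumberTheory.EllipticCurves.Rank1Residual
  Summit.BirchSwinnertonDyer.Rank1Residual.X1.MuLambda
  Summit.BirchSwinnertonDyer.Rank1Residual.Iwasawa

namespace Summit.BirchSwinnertonDyer.Rank1Residual.Supersingular

/-! ## §14. The certified colour is non-zero -/

section NeZero

variable {p : ℕ} [hp : Fact p.Prime]

/-- **`L♯ ≢ 0 (mod p)` from the odd-level reading.** `p ∣ a_p`, `n` odd,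
`Θ = ω_n Q − (u_n A + v_n B)` in `Λ` with `Θ ≠ 0`, `μ(Θ) = 0`, `λ(Θ) < pⁿ` ⇒ `A ≠ 0` (indeed
`red A ≠ 0`: mod `p`, `Θ̄ = T^{pⁿ}Q̄ ∓ T^{deg ω_n^+}Ā` has order `< pⁿ`).
[cite: Pollack2003, Prop. 6.9 and Prop. 6.10] [cite: Sprung2017, §3 and Cor. 3.6] -/
theorem sharp_ne_zero_of_reading {ap : ℤ} (hap : (p : ℤ) ∣ ap) {n : ℕ} (hn : Odd n)
    {A B Q Θ : IwasawaAlgebra p}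
    (hΘ : Θ = toIwasawa p (cyclotomicOmega p n) * Q -
      (toIwasawa p (sharpPoly ap p n) * A + toIwasawa p (flatPoly ap p n) * B))
    (hΘ0 : Θ ≠ 0) (hμ : mu Θ = 0) (hlt : lam Θ < p ^ n) : A ≠ 0 := by
  have red_mul' : ∀ a b : IwasawaAlgebra p, red (a * b) = red a * red b := fun a b ↦ map_mul _ a b
  have red_add' : ∀ a b : IwasawaAlgebra p, red (a + b) = red a + red b := fun a b ↦ map_add _ a b
  have red_sub' : ∀ a b : IwasawaAlgebra p, red (a - b) = red a - red b := fun a b ↦ map_sub _ a b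
  have hredΘ : red Θ ≠ 0 := red_ne_zero_of_mu_eq_zero hΘ0 hμ
  obtain ⟨-, hlamΘ⟩ := mu_eq_zero_and_lam_eq_of_red_ne_zero hredΘ
  set U : PowerSeries (IsLocalRing.ResidueField ℤ_[p]) :=
    PowerSeries.C (-(-1 : IsLocalRing.ResidueField ℤ_[p]) ^ (n / 2)) *
      PowerSeries.X ^ (cyclotomicOmegaPlus p n).natDegree with hU_def
  have hred : red Θ = PowerSeries.X ^ (p ^ n) * red Q + U * red A := by
    rw [hΘ, red_sub', red_mul', red_add', red_mul', red_mul', red_toIwasawa_cyclotomicOmega,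
      red_toIwasawa_sharpPoly_of_odd hap hn, red_toIwasawa_flatPoly_of_odd hap hn, zero_mul, add_zero,
      hU_def, map_neg, map_pow, map_neg, map_one]
    ring
  have hltM : (red Θ).order < (p ^ n : ℕ) := by
    rw [← hlamΘ]
    exact_mod_cast hlt
  obtain ⟨hA, -⟩ := order_eq_of_eq_X_pow_mul_add hred hltM
  rintro rfl
  exact hA (by simp [red])

/-- **`L♭ ≢ 0 (mod p)` from the even-level reading** (`n` even, colour `B`).
[cite: Pollack2003, Prop. 6.9 and Prop. 6.10] [cite: Sprung2017, §3 and Cor. 3.6] -/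
theorem flat_ne_zero_of_reading {ap : ℤ} (hap : (p : ℤ) ∣ ap) {n : ℕ} (hn : Even n)
    {A B Q Θ : IwasawaAlgebra p}
    (hΘ : Θ = toIwasawa p (cyclotomicOmega p n) * Q -
      (toIwasawa p (sharpPoly ap p n) * A + toIwasawa p (flatPoly ap p n) * B))
    (hΘ0 : Θ ≠ 0) (hμ : mu Θ = 0) (hlt : lam Θ < p ^ n) : B ≠ 0 := by
  have red_mul' : ∀ a b : IwasawaAlgebra p, red (a * b) = red a * red b := fun a b ↦ map_mul _ a b
  have red_add' : ∀ a b : IwasawaAlgebra p, red (a + b) = red a + red b := fun a b ↦ map_add _ a b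
  have red_sub' : ∀ a b : IwasawaAlgebra p, red (a - b) = red a - red b := fun a b ↦ map_sub _ a b
  have hredΘ : red Θ ≠ 0 := red_ne_zero_of_mu_eq_zero hΘ0 hμ
  obtain ⟨-, hlamΘ⟩ := mu_eq_zero_and_lam_eq_of_red_ne_zero hredΘ
  set U : PowerSeries (IsLocalRing.ResidueField ℤ_[p]) :=
    PowerSeries.C (-(-1 : IsLocalRing.ResidueField ℤ_[p]) ^ (n / 2)) *
      PowerSeries.X ^ (cyclotomicOmegaMinus p n).natDegree with hU_def
  have hred : red Θ = PowerSeries.X ^ (p ^ n) * red Q + U * red B := by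
    rw [hΘ, red_sub', red_mul', red_add', red_mul', red_mul', red_toIwasawa_cyclotomicOmega,
      red_toIwasawa_sharpPoly_of_even hap hn, red_toIwasawa_flatPoly_of_even hap hn, zero_mul, zero_add,
      hU_def, map_neg, map_pow, map_neg, map_one]
    ring
  have hltM : (red Θ).order < (p ^ n : ℕ) := by
    rw [← hlamΘ]
    exact_mod_cast hlt
  obtain ⟨hB, -⟩ := order_eq_of_eq_X_pow_mul_add hred hltM
  rintro rfl
  exact hB (by simp [red])

variable {W : WeierstrassCurve ℚ} [W.IsElliptic] [W.IsGloballyMinimal] {N : ℕ} [NeZero N]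
  {f : CuspForm (Gamma0 N) 2}

/-- **ONE twisted value of small valuation gives `L♯ ≠ 0`.** `p ≠ 2` good supersingular, `f` the
newform, ANY Sprung pair, `n = k+1` odd: ONE primitive even `p`-power-order `χ` mod `p^{n+e₀}` with
`|∑_a χ(a)[a/p^{n+e₀}]⁺_f| > 1/p` ⇒ `L♯ ≠ 0` (per-pair certified instance of Sprung's Conj. 4.12).
[cite: Sprung2017, §3, Cor. 3.6, Thm. 1.12 and Conj. 4.12] [cite: Pollack2003, Prop. 6.9 and Prop. 6.10] -/
theorem sharp_ne_zero_of_lt_norm (hp2 : p ≠ 2) (hf : IsNewformOf W f)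
    (hgood : W.HasGoodReductionAtPrime p) (hap : (p : ℤ) ∣ W.frobeniusTrace p)
    {Lsharp Lflat : IwasawaAlgebra p} (hSP : IsSprungPair f p (W.frobeniusTrace p) Lsharp Lflat)
    {k : ℕ} (hn : Odd (k + 1)) (χ : DirichletCharacter ℂ_[p] (p ^ (k + 1 + cyclotomicExponent p)))
    (hχ : χ.IsPrimitive) (hev : χ.Even) (hord : ∃ j : ℕ, orderOf χ = p ^ j)
    (h : (p : ℝ)⁻¹ < ‖ratTwistedSymbolSum f χ‖) : Lsharp ≠ 0 := by
  obtain ⟨Q, hQ⟩ := exists_integral_mazurTate_of_isSprungPair hp2 hf hgood hap hSP (k + 1)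
  have hΘ0 := mazurTate_model_ne_zero_of_lt_norm hQ.symm χ hev hord h
  obtain ⟨hμΘ, hlamΘ, -⟩ :=
    mazurTate_mu_eq_zero_and_lam_lt_totient_of_lt_norm hQ.symm hΘ0 χ hχ hev hord h
  exact sharp_ne_zero_of_reading hap hn rfl hΘ0 hμΘ (lt_of_lt_of_le hlamΘ (Nat.totient_le _))

/-- **ONE twisted value of small valuation gives `L♭ ≠ 0`** (even `n = k+1`).
[cite: Sprung2017, §3, Cor. 3.6, Thm. 1.12 and Conj. 4.12] [cite: Pollack2003, Prop. 6.9 and Prop. 6.10] -/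
theorem flat_ne_zero_of_lt_norm (hp2 : p ≠ 2) (hf : IsNewformOf W f)
    (hgood : W.HasGoodReductionAtPrime p) (hap : (p : ℤ) ∣ W.frobeniusTrace p)
    {Lsharp Lflat : IwasawaAlgebra p} (hSP : IsSprungPair f p (W.frobeniusTrace p) Lsharp Lflat)
    {k : ℕ} (hn : Even (k + 1)) (χ : DirichletCharacter ℂ_[p] (p ^ (k + 1 + cyclotomicExponent p)))
    (hχ : χ.IsPrimitive) (hev : χ.Even) (hord : ∃ j : ℕ, orderOf χ = p ^ j)
    (h : (p : ℝ)⁻¹ < ‖ratTwistedSymbolSum f χ‖) : Lflat ≠ 0 := by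
  obtain ⟨Q, hQ⟩ := exists_integral_mazurTate_of_isSprungPair hp2 hf hgood hap hSP (k + 1)
  have hΘ0 := mazurTate_model_ne_zero_of_lt_norm hQ.symm χ hev hord h
  obtain ⟨hμΘ, hlamΘ, -⟩ :=
    mazurTate_mu_eq_zero_and_lam_lt_totient_of_lt_norm hQ.symm hΘ0 χ hχ hev hord h
  exact flat_ne_zero_of_reading hap hn rfl hΘ0 hμΘ (lt_of_lt_of_le hlamΘ (Nat.totient_le _))

end NeZero

/-! ## §15. Propagation of the hypothesis `λ + deg ω_n^± < φ(pⁿ)` to deeper layers -/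

section Propagation

variable (p : ℕ) [hp : Fact p.Prime]

/-- `φ(pⁿ) + φ(pⁿ⁺¹) ≤ φ(pⁿ⁺²)` for `n ≥ 1`... in the form needed: `a < φ(pⁿ) ⇒ a + φ(pⁿ⁺¹) < φ(pⁿ⁺²)`
for any `n` (`φ(pⁿ⁺²) = p·φ(pⁿ⁺¹) ≥ φ(pⁿ⁺¹) + φ(pⁿ)`). [folklore] -/
theorem add_totient_succ_lt_totient_add_two {a n : ℕ} (h : a < Nat.totient (p ^ n)) :
    a + Nat.totient (p ^ (n + 1)) < Nat.totient (p ^ (n + 2)) := by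
  have hP := hp.out
  have h2 : 2 ≤ p := hP.two_le
  have hφ1 : Nat.totient (p ^ (n + 1)) = p ^ n * (p - 1) := Nat.totient_prime_pow_succ hP n
  have hφ2 : Nat.totient (p ^ (n + 2)) = p ^ (n + 1) * (p - 1) := Nat.totient_prime_pow_succ hP (n + 1)
  have hφ0 : Nat.totient (p ^ n) ≤ p ^ n := Nat.totient_le _
  have hpow : p ^ (n + 1) = p ^ n * p := pow_succ p n
  rw [hφ1, hφ2, hpow]
  have hp1 : 1 ≤ p - 1 := by omega
  have hkey : p ^ n + p ^ n * (p - 1) ≤ p ^ n * p * (p - 1) := by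
    have : p ^ n * p * (p - 1) = p ^ n * (p - 1) + p ^ n * (p - 1) * (p - 1) := by
      zify [hP.one_le]
      ring
    rw [this]
    nlinarith [Nat.one_le_pow n p hP.pos]
  omega

/-- **Propagation along the odd layers**: `l + deg ω_n^+ < φ(pⁿ)` at an odd `n` implies
`l + deg ω_m^+ < φ(pᵐ)` at every odd `m ≥ n`. [cite: Pollack2003, §6.5 and Lemma 4.7] -/
theorem add_natDegree_cyclotomicOmegaPlus_lt_totient_of_le {l n m : ℕ} (hn : Odd n) (hm : Odd m)
    (hnm : n ≤ m) (h : l + (cyclotomicOmegaPlus p n).natDegree < Nat.totient (p ^ n)) :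
    l + (cyclotomicOmegaPlus p m).natDegree < Nat.totient (p ^ m) := by
  obtain ⟨a, rfl⟩ := hn
  obtain ⟨b, rfl⟩ := hm
  obtain ⟨d, rfl⟩ : ∃ d, b = a + d := ⟨b - a, by omega⟩
  clear hnm
  induction d with
  | zero => simpa using h
  | succ d ih =>
    rw [show 2 * (a + (d + 1)) + 1 = (2 * (a + d) + 1) + 2 by ring,
      natDegree_cyclotomicOmegaPlus_add_two p ⟨a + d, rfl⟩, ← add_assoc]
    exact add_totient_succ_lt_totient_add_two p ih

/-- **Propagation along the even layers**: `l + deg ω_n^- < φ(pⁿ)` at an even `n` implies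
`l + deg ω_m^- < φ(pᵐ)` at every even `m ≥ n`. [cite: Pollack2003, §6.5 and Lemma 4.7] -/
theorem add_natDegree_cyclotomicOmegaMinus_lt_totient_of_le {l n m : ℕ} (hn : Even n) (hm : Even m)
    (hnm : n ≤ m) (h : l + (cyclotomicOmegaMinus p n).natDegree < Nat.totient (p ^ n)) :
    l + (cyclotomicOmegaMinus p m).natDegree < Nat.totient (p ^ m) := by
  obtain ⟨a, rfl⟩ := hn
  obtain ⟨b, rfl⟩ := hm
  obtain ⟨d, rfl⟩ : ∃ d, b = a + d := ⟨b - a, by omega⟩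
  clear hnm
  induction d with
  | zero => simpa using h
  | succ d ih =>
    rw [show a + (d + 1) + (a + (d + 1)) = (a + d + (a + d)) + 2 by ring,
      natDegree_cyclotomicOmegaMinus_add_two p ⟨a + d, rfl⟩, ← add_assoc]
    exact add_totient_succ_lt_totient_add_two p ih

end Propagation

/-! ## §16. ONE value ⇒ the valuation of every deeper twist of the same parity -/

section OneValue

variable {W : WeierstrassCurve ℚ} [W.IsElliptic] [W.IsGloballyMinimal] {N : ℕ} [NeZero N]
  {f : CuspForm (Gamma0 N) 2} {p : ℕ} [hp : Fact p.Prime]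

/-- **ONE VALUE ⇒ ALL DEEPER ODD LAYERS (colour `♯`).** `p ≠ 2` good supersingular, `f` the
newform of `E = W`, ANY Sprung pair. If ONE primitive even `p`-power-order `χ` of conductor
`p^{n+e₀}`, `n = k+1` odd, has `|∑_a χ(a)[a/p^{n+e₀}]⁺_f| > 1/p`, then for EVERY odd `m = j+1 ≥ n`
and every primitive even `p`-power-order `χ'` of conductor `p^{m+e₀}`:
`|∑_a χ'(a)[a/p^{m+e₀}]⁺_f|^{φ(pᵐ)} = p^{−(deg ω_m^+ + λ(L♯))}` — where `λ(L♯)` is itself determined by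
`χ` (`λ♯ + deg ω_n^+ = φ(pⁿ)·v_p(Birch(χ))`, part 4 §10).
[cite: Pollack2003, Prop. 6.9 and Prop. 6.10] [cite: Sprung2017, §3, Cor. 3.6 and Thm. 1.12] -/
theorem norm_ratTwistedSymbolSum_pow_totient_eq_of_lt_norm_of_le (hp2 : p ≠ 2)
    (hf : IsNewformOf W f) (hgood : W.HasGoodReductionAtPrime p) (hap : (p : ℤ) ∣ W.frobeniusTrace p)
    {Lsharp Lflat : IwasawaAlgebra p} (hSP : IsSprungPair f p (W.frobeniusTrace p) Lsharp Lflat)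
    {k : ℕ} (hn : Odd (k + 1)) (χ : DirichletCharacter ℂ_[p] (p ^ (k + 1 + cyclotomicExponent p)))
    (hχ : χ.IsPrimitive) (hev : χ.Even) (hord : ∃ j : ℕ, orderOf χ = p ^ j)
    (h : (p : ℝ)⁻¹ < ‖ratTwistedSymbolSum f χ‖) {j : ℕ} (hm : Odd (j + 1)) (hkj : k ≤ j)
    (χ' : DirichletCharacter ℂ_[p] (p ^ (j + 1 + cyclotomicExponent p))) (hχ' : χ'.IsPrimitive)
    (hev' : χ'.Even) (hord' : ∃ i : ℕ, orderOf χ' = p ^ i) :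
    ‖ratTwistedSymbolSum f χ'‖ ^ Nat.totient (p ^ (j + 1)) =
      ((p : ℝ)⁻¹) ^ ((cyclotomicOmegaPlus p (j + 1)).natDegree + lam Lsharp) := by
  obtain ⟨hμ, hlt, -⟩ := mu_sharp_eq_zero_and_lam_sharp_add_eq_of_lt_norm hp2 hf hgood hap hSP hn χ
    hχ hev hord h
  have hL0 := sharp_ne_zero_of_lt_norm hp2 hf hgood hap hSP hn χ hχ hev hord h
  exact norm_ratTwistedSymbolSum_pow_totient_eq_of_lam_sharp hp2 hf hgood hap hSP hL0 hμ hm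
    (add_natDegree_cyclotomicOmegaPlus_lt_totient_of_le p hn hm (by omega) hlt) χ' hχ' hev' hord'

/-- **ONE VALUE ⇒ ALL DEEPER EVEN LAYERS (colour `♭`)**: same with `n = k+1`, `m = j+1` even.
[cite: Pollack2003, Prop. 6.9 and Prop. 6.10] [cite: Sprung2017, §3, Cor. 3.6 and Thm. 1.12] -/
theorem norm_ratTwistedSymbolSum_pow_totient_eq_of_lt_norm_of_le_flat (hp2 : p ≠ 2)
    (hf : IsNewformOf W f) (hgood : W.HasGoodReductionAtPrime p) (hap : (p : ℤ) ∣ W.frobeniusTrace p)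
    {Lsharp Lflat : IwasawaAlgebra p} (hSP : IsSprungPair f p (W.frobeniusTrace p) Lsharp Lflat)
    {k : ℕ} (hn : Even (k + 1)) (χ : DirichletCharacter ℂ_[p] (p ^ (k + 1 + cyclotomicExponent p)))
    (hχ : χ.IsPrimitive) (hev : χ.Even) (hord : ∃ j : ℕ, orderOf χ = p ^ j)
    (h : (p : ℝ)⁻¹ < ‖ratTwistedSymbolSum f χ‖) {j : ℕ} (hm : Even (j + 1)) (hkj : k ≤ j)
    (χ' : DirichletCharacter ℂ_[p] (p ^ (j + 1 + cyclotomicExponent p))) (hχ' : χ'.IsPrimitive)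
    (hev' : χ'.Even) (hord' : ∃ i : ℕ, orderOf χ' = p ^ i) :
    ‖ratTwistedSymbolSum f χ'‖ ^ Nat.totient (p ^ (j + 1)) =
      ((p : ℝ)⁻¹) ^ ((cyclotomicOmegaMinus p (j + 1)).natDegree + lam Lflat) := by
  obtain ⟨hμ, hlt, -⟩ := mu_flat_eq_zero_and_lam_flat_add_eq_of_lt_norm hp2 hf hgood hap hSP hn χ
    hχ hev hord h
  have hL0 := flat_ne_zero_of_lt_norm hp2 hf hgood hap hSP hn χ hχ hev hord h
  exact norm_ratTwistedSymbolSum_pow_totient_eq_of_lam_flat hp2 hf hgood hap hSP hL0 hμ hm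
    (add_natDegree_cyclotomicOmegaMinus_lt_totient_of_le p hn hm (by omega) hlt) χ' hχ' hev' hord'

end OneValue

/-! ## §17. Class X8 -/

section X8

variable {W : WeierstrassCurve ℚ} [W.IsElliptic] [W.IsGloballyMinimal] {N : ℕ} [NeZero N]
  {f : CuspForm (Gamma0 N) 2} {p : ℕ} [hp : Fact p.Prime]

/-- **X8: ONE conductor-`3^{n+1}` twisted value with `|·| > 1/3` (`n` odd) determines the `3`-adic
valuation of EVERY twist of conductor `3^{m+1}`, `m ≥ n` odd**: `|Birch(χ')|^{φ(3ᵐ)} =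
3^{−(deg ω_m^+ + λ♯)}` — e.g. one conductor-`9` value of valuation `1/2` (tight, `λ♯ = 1`) ⇒
`v_3 = 7/18` at conductor `81`, `61/162` at `729`, …. [cite: Sprung2017, §3, Cor. 3.6 and Thm. 1.12]
[cite: Pollack2003, Prop. 6.9 and Prop. 6.10] -/
theorem X8.norm_ratTwistedSymbolSum_pow_totient_eq_of_lt_norm_of_le (hX : ClassX8 W p)
    (hf : IsNewformOf W f) {Lsharp Lflat : IwasawaAlgebra p}
    (hSP : IsSprungPair f p (W.frobeniusTrace p) Lsharp Lflat) {k : ℕ} (hn : Odd (k + 1))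
    (χ : DirichletCharacter ℂ_[p] (p ^ (k + 1 + cyclotomicExponent p))) (hχ : χ.IsPrimitive)
    (hev : χ.Even) (hord : ∃ j : ℕ, orderOf χ = p ^ j) (h : (p : ℝ)⁻¹ < ‖ratTwistedSymbolSum f χ‖)
    {j : ℕ} (hm : Odd (j + 1)) (hkj : k ≤ j)
    (χ' : DirichletCharacter ℂ_[p] (p ^ (j + 1 + cyclotomicExponent p))) (hχ' : χ'.IsPrimitive)
    (hev' : χ'.Even) (hord' : ∃ i : ℕ, orderOf χ' = p ^ i) :
    ‖ratTwistedSymbolSum f χ'‖ ^ Nat.totient (p ^ (j + 1)) =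
      ((p : ℝ)⁻¹) ^ ((cyclotomicOmegaPlus p (j + 1)).natDegree + lam Lsharp) := by
  obtain ⟨rfl, ⟨hgood, hap⟩, -⟩ := hX
  exact norm_ratTwistedSymbolSum_pow_totient_eq_of_lt_norm_of_le (by decide) hf hgood hap hSP hn χ hχ
    hev hord h hm hkj χ' hχ' hev' hord'

/-- **X8, colour `♭`**: one conductor-`3^{n+1}` value with `|·| > 1/3`, `n` even, determines every
twist of conductor `3^{m+1}`, `m ≥ n` even. [cite: Sprung2017, §3, Cor. 3.6 and Thm. 1.12]
[cite: Pollack2003, Prop. 6.9 and Prop. 6.10] -/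
theorem X8.norm_ratTwistedSymbolSum_pow_totient_eq_of_lt_norm_of_le_flat (hX : ClassX8 W p)
    (hf : IsNewformOf W f) {Lsharp Lflat : IwasawaAlgebra p}
    (hSP : IsSprungPair f p (W.frobeniusTrace p) Lsharp Lflat) {k : ℕ} (hn : Even (k + 1))
    (χ : DirichletCharacter ℂ_[p] (p ^ (k + 1 + cyclotomicExponent p))) (hχ : χ.IsPrimitive)
    (hev : χ.Even) (hord : ∃ j : ℕ, orderOf χ = p ^ j) (h : (p : ℝ)⁻¹ < ‖ratTwistedSymbolSum f χ‖)
    {j : ℕ} (hm : Even (j + 1)) (hkj : k ≤ j)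
    (χ' : DirichletCharacter ℂ_[p] (p ^ (j + 1 + cyclotomicExponent p))) (hχ' : χ'.IsPrimitive)
    (hev' : χ'.Even) (hord' : ∃ i : ℕ, orderOf χ' = p ^ i) :
    ‖ratTwistedSymbolSum f χ'‖ ^ Nat.totient (p ^ (j + 1)) =
      ((p : ℝ)⁻¹) ^ ((cyclotomicOmegaMinus p (j + 1)).natDegree + lam Lflat) := by
  obtain ⟨rfl, ⟨hgood, hap⟩, -⟩ := hX
  exact norm_ratTwistedSymbolSum_pow_totient_eq_of_lt_norm_of_le_flat (by decide) hf hgood hap hSP hn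
    χ hχ hev hord h hm hkj χ' hχ' hev' hord'

end X8

end Summit.BirchSwinnertonDyer.Rank1Residual.Supersingular

end
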